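import Summits.AnomalousDissipation.AnomalousDissipation.Theorems.ImpulseGridGridSignsLawStubProfileFluxLaw
import Summits.AnomalousDissipation.AnomalousDissipation.Theorems.ImpulseGridGridThesisStubAcdcDesignCalculus
import Summits.AnomalousDissipation.AnomalousDissipation.Theorems.ImpulseGridGridThesisStubAcdcDesignIntegrals

/-!
# Line `Sketch` for crux `GridSignsLaw` (item stmt-AnomalousDissipation-14349, route ImpulseGrid) —
stub `stub_acdcQuadratureDictionary`: the quadrature dictionary of the explicit AC/DC grid

For the explicit AC/DC design — slab profile `Φ = 1 + 2θ cos 2πx₀ = 1 + 2θ Re e₀` with the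
streamwise character `e₀ = e^{2πi x₀}` (`UnitAddTorus.mFourier (Pi.single 0 1)`), the cellular
two-mode Stokes pattern `G = A[sin 2πm(x₁+x₂)(e₁−e₂) + sin 2πm(x₁−x₂)(e₁+e₂)]` and the quadrature
pair `C = (Re e₀) G`, `S = (Im e₀) G` — any constant `c` (`w := u − c e₀`) and every global
Leray–Hopf solution forced by `Φ•G` with a sup-energy bound satisfy, in every generalized
long-time limit `Λ`:

1. `2πc·Λ⟨(C,u)⟩ = −Λ⟨∫⟪w,(w·∇)S⟫⟩ − νΛ⟨(u,ΔS)⟩`;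
2. `2πc·Λ⟨(S,u)⟩ = Λ⟨∫⟪w,(w·∇)C⟫⟩ + νΛ⟨(u,ΔC)⟩ + θ∫‖G‖²`.

Both are the profile flux law `stub_profileFluxLaw`
(`c·Λ⟨(∂₀ρ•G,u)⟩ + Λ⟨∫⟪w,(w·∇)(ρG)⟫⟩ + νΛ⟨(u,Δ(ρG))⟩ + ∫Φρ‖G‖² = 0` for every smooth weight `ρ`
of `x₀` alone) at the two quadrature weights: `ρ = (2π)⁻¹ Im e₀` (`∂₀ρ = Re e₀`, `ρG = (2π)⁻¹S`,
`∫Φρ‖G‖² = (2π)⁻¹(Φ•G,S) = 0`) and `ρ = −(2π)⁻¹ Re e₀` (`∂₀ρ = Im e₀`, `ρG = −(2π)⁻¹C`,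
`∫Φρ‖G‖² = −(2π)⁻¹(Φ•G,C) = −(2π)⁻¹θ∫‖G‖²`). The design clauses (smoothness, invariances,
`G₀ = 0`, `div G = 0`, the pairings `(Φ•G,C) = θ‖G‖₂²`, `(Φ•G,S) = 0`) are
`stub_acdcDesignCalculus` / `stub_acdcDesignIntegrals` of the sibling `GridThesis` line; the
constants are pulled through `(w·∇)`, `Δ`, `∫` and `Λ⟨·⟩` by `convect_const_smul`,
`laplacian_const_smul`, `integral_const_mul`, `GridInjection.longTimeAvg_const_mul`.
No new definitions.

References: Foias–Manley–Rosa–Temam 2001, Ch. IV §3.1; Doering–Foias 2002 §2 (bookkeeping of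
body-forced Navier–Stokes in generalized limits); Grafakos 2014, Prop. 3.2.6 (derivatives of
characters).
-/

noncomputable section

-- `Summit.<Summit>.<Problem>` is the tree's mandated summit-side namespace (CONVENTIONS §2); for this
-- single-conjunct summit the two coincide, so the duplicate is deliberate.
set_option linter.dupNamespace false

open MeasureTheory Set Filter Topology
open scoped InnerProductSpace RealInnerProductSpace

namespace Summit.AnomalousDissipation.AnomalousDissipation.Theorems

open Literature.Analysis.FunctionSpaces Literature.Analysis.FunctionSpaces.Torus
open Literature.Analysis.FluidPDE Literature.Analysis.FluidPDE.Torus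

local notation "𝕋³" => UnitAddTorus (Fin 3)
local notation "E³" => EuclideanSpace ℝ (Fin 3)

namespace AcdcQuadrature

/-! ### Derivatives of the real part of a character; the two quadrature weights -/

/-- `∂ⱼ Re e_l = −2π lⱼ Im e_l` (from `∂ⱼ e_l = 2πi lⱼ e_l`, Grafakos 2014, Prop. 3.2.6; the `Re`
twin of `AcdcDesign.partialDeriv_im_mFourier`). [folklore] -/
theorem partialDeriv_re_mFourier (l : Fin 3 → ℤ) (j : Fin 3) (x : 𝕋³) :
    partialDeriv j (fun y => (UnitAddTorus.mFourier l y).re) x =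
      -(2 * Real.pi * (l j : ℝ) * (UnitAddTorus.mFourier l x).im) := by
  have h := partialDeriv_clm_comp (isSmooth_mFourier l) Complex.reCLM j x
  rw [partialDeriv_mFourier] at h
  have e : (fun y => (UnitAddTorus.mFourier l y).re) =
      (⇑Complex.reCLM ∘ ⇑(UnitAddTorus.mFourier l)) := rfl
  rw [e, h]
  simp

/-- `∂ⱼ (a Re e_l) = a · (−2π lⱼ Im e_l)` for a real constant `a`. [folklore] -/
theorem partialDeriv_const_mul_re_mFourier (a : ℝ) (l : Fin 3 → ℤ) (j : Fin 3) (x : 𝕋³) :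
    partialDeriv j (fun y => a * (UnitAddTorus.mFourier l y).re) x =
      a * -(2 * Real.pi * (l j : ℝ) * (UnitAddTorus.mFourier l x).im) := by
  have e : (fun y => a * (UnitAddTorus.mFourier l y).re) =
      a • (fun y => (UnitAddTorus.mFourier l y).re) := by
    funext y
    simp only [Pi.smul_apply, smul_eq_mul]
  rw [e, partialDeriv_const_smul ((AcdcDesign.isSmooth_re_mFourier l).isContDiff (by simp)) a j,
    Pi.smul_apply, partialDeriv_re_mFourier, smul_eq_mul]

/-- The streamwise character `e₀` is invariant under the `x₁`- and `x₂`-translations. [folklore] -/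
theorem mFourier_e₀_add_single {i : Fin 3} (hi : i ≠ 0) (s : UnitAddCircle) (x : 𝕋³) :
    UnitAddTorus.mFourier (Pi.single (0 : Fin 3) (1 : ℤ)) (x + Pi.single i s) =
      UnitAddTorus.mFourier (Pi.single (0 : Fin 3) (1 : ℤ)) x :=
  AcdcDesign.mFourier_add_single_of_apply_eq_zero (Pi.single_eq_of_ne hi _) x s

/-- **The sine weight** `ρ = (2π)⁻¹ Im e₀ = (2π)⁻¹ sin 2πx₀`: smooth, `x₁,x₂`-invariant, and
`∂₀ρ = Re e₀ = cos 2πx₀`. [folklore] -/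
theorem weight_sin (ρ : 𝕋³ → ℝ)
    (hρ : ρ = fun x =>
      (2 * Real.pi)⁻¹ * (UnitAddTorus.mFourier (Pi.single (0 : Fin 3) (1 : ℤ)) x).im) :
    IsSmooth ρ ∧
    (∀ (s : UnitAddCircle) x, ρ (x + Pi.single (1 : Fin 3) s) = ρ x ∧
      ρ (x + Pi.single (2 : Fin 3) s) = ρ x) ∧
    ∀ x, partialDeriv 0 ρ x = (UnitAddTorus.mFourier (Pi.single (0 : Fin 3) (1 : ℤ)) x).re := by
  have h2π : (2 * Real.pi : ℝ) ≠ 0 := by positivity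
  subst hρ
  refine ⟨?_, fun s x => ?_, fun x => ?_⟩
  · exact contDiff_const.mul (AcdcDesign.isSmooth_im_mFourier _)
  · simp only [mFourier_e₀_add_single (show (1 : Fin 3) ≠ 0 by decide),
      mFourier_e₀_add_single (show (2 : Fin 3) ≠ 0 by decide), and_self]
  · rw [AcdcDesign.partialDeriv_const_mul_im_mFourier]
    simp only [Pi.single_eq_same, Int.cast_one, mul_one]
    rw [inv_mul_cancel_left₀ h2π]

/-- **The cosine weight** `ρ = −(2π)⁻¹ Re e₀ = −(2π)⁻¹ cos 2πx₀`: smooth, `x₁,x₂`-invariant, and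
`∂₀ρ = Im e₀ = sin 2πx₀`. [folklore] -/
theorem weight_cos (ρ : 𝕋³ → ℝ)
    (hρ : ρ = fun x =>
      -(2 * Real.pi)⁻¹ * (UnitAddTorus.mFourier (Pi.single (0 : Fin 3) (1 : ℤ)) x).re) :
    IsSmooth ρ ∧
    (∀ (s : UnitAddCircle) x, ρ (x + Pi.single (1 : Fin 3) s) = ρ x ∧
      ρ (x + Pi.single (2 : Fin 3) s) = ρ x) ∧
    ∀ x, partialDeriv 0 ρ x = (UnitAddTorus.mFourier (Pi.single (0 : Fin 3) (1 : ℤ)) x).im := by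
  have h2π : (2 * Real.pi : ℝ) ≠ 0 := by positivity
  subst hρ
  refine ⟨?_, fun s x => ?_, fun x => ?_⟩
  · exact contDiff_const.mul (AcdcDesign.isSmooth_re_mFourier _)
  · simp only [mFourier_e₀_add_single (show (1 : Fin 3) ≠ 0 by decide),
      mFourier_e₀_add_single (show (2 : Fin 3) ≠ 0 by decide), and_self]
  · rw [partialDeriv_const_mul_re_mFourier]
    simp only [Pi.single_eq_same, Int.cast_one, mul_one]
    rw [neg_mul_neg, inv_mul_cancel_left₀ h2π]

/-! ### The profile flux law at a weight whose product with the pattern is a constant multiple -/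

/-- **The profile flux law at a rescaled test field.** If the smooth `x₀`-weight `ρ` has
`∂₀ρ • G = T` and `ρ • G = a • V` pointwise (`V` smooth, `a` a real constant), then
`stub_profileFluxLaw` reads
`c·Λ⟨(T,u)⟩ + a·Λ⟨∫⟪w,(w·∇)V⟫⟩ + ν·(a·Λ⟨(u,ΔV)⟩) + ∫Φρ‖G‖² = 0`: the constant `a` is pulled
through `(w·∇)` (`convect_const_smul`), `Δ` (`laplacian_const_smul`), the space integral
(`integral_const_mul`) and the generalized long-time average (`GridInjection.longTimeAvg_const_mul`).
[folklore] -/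
theorem profileFluxLaw_smul (Λ : GeneralizedLimit) (ν c a : ℝ) (Φ ρ : 𝕋³ → ℝ) (G T V : 𝕋³ → E³)
    (u₀ : 𝕋³ → E³) (u : ℝ → 𝕋³ → E³) (hν : 0 < ν) (hΦ : IsSmooth Φ) (hρ : IsSmooth ρ)
    (hG : IsSmooth G)
    (hρinv : ∀ (s : UnitAddCircle) x, ρ (x + Pi.single (1 : Fin 3) s) = ρ x ∧
      ρ (x + Pi.single (2 : Fin 3) s) = ρ x)
    (hGinv : ∀ (s : UnitAddCircle) x, G (x + Pi.single (0 : Fin 3) s) = G x) (hG0 : ∀ x, G x 0 = 0)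
    (hGdiv : IsDivFree G) (hV : IsSmooth V) (hT : ∀ x, partialDeriv 0 ρ x • G x = T x)
    (hρG : ∀ x, ρ x • G x = a • V x)
    (hu : IsGlobalLerayHopf ν (fun _ => fun x => Φ x • G x) u₀ u)
    (hE : ∃ K : ℝ, ∀ t : ℝ, 0 ≤ t → kineticEnergy (u t) ≤ K) :
    c * Λ.longTimeAvg (fun t => ∫ x, ⟪T x, u t x⟫) +
      a * Λ.longTimeAvg (fun t => ∫ x, ⟪u t x - c • EuclideanSpace.single 0 1,
        convect (fun y => u t y - c • EuclideanSpace.single 0 1) V x⟫) +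
      ν * (a * Λ.longTimeAvg (fun t => ∫ x, ⟪u t x, laplacian V x⟫)) +
      ∫ x, Φ x * ρ x * ‖G x‖ ^ 2 = 0 := by
  have h := stub_profileFluxLaw Λ ν c Φ ρ G u₀ u hν hΦ hρ hG hρinv hGinv hG0 hGdiv hu hE
  have hVeq : (fun y => ρ y • G y) = fun y => a • V y := funext hρG
  have hV1 : IsContDiff 1 V := hV.isContDiff (by simp)
  -- `(∂₀ρ•G, u t) = (T, u t)`
  have e1 : (fun t => ∫ x, ⟪partialDeriv 0 ρ x • G x, u t x⟫) = fun t => ∫ x, ⟪T x, u t x⟫ := by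
    funext t
    refine integral_congr_ae (ae_of_all _ fun x => ?_)
    dsimp only
    rw [hT x]
  -- `∫⟪w, (w·∇)(ρG)⟫ = a ∫⟪w, (w·∇)V⟫`
  have e2 : (fun t => ∫ x, ⟪u t x - c • EuclideanSpace.single 0 1,
      convect (fun y => u t y - c • EuclideanSpace.single 0 1) (fun y => ρ y • G y) x⟫) =
      fun t => a * ∫ x, ⟪u t x - c • EuclideanSpace.single 0 1,
        convect (fun y => u t y - c • EuclideanSpace.single 0 1) V x⟫ := by
    funext t
    rw [← integral_const_mul]
    refine integral_congr_ae (ae_of_all _ fun x => ?_)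
    dsimp only
    rw [hVeq, convect_const_smul _ hV1 a x, real_inner_smul_right]
  -- `(u t, Δ(ρG)) = a (u t, ΔV)`
  have e3 : (fun t => ∫ x, ⟪u t x, laplacian (fun y => ρ y • G y) x⟫) =
      fun t => a * ∫ x, ⟪u t x, laplacian V x⟫ := by
    funext t
    rw [← integral_const_mul]
    refine integral_congr_ae (ae_of_all _ fun x => ?_)
    dsimp only
    rw [hVeq, laplacian_const_smul hV a x, real_inner_smul_right]
  rw [e1, e2, e3, GridInjection.longTimeAvg_const_mul, GridInjection.longTimeAvg_const_mul] at h
  exact h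

end AcdcQuadrature

/-- **Stub `stub_acdcQuadratureDictionary` of line `Sketch` (crux `GridSignsLaw`,
stmt-AnomalousDissipation-14349): the quadrature dictionary of the AC/DC grid.** For the explicit
design (`Φ = 1 + 2θ cos 2πx₀`, cellular `G`, quadrature pair `C = cos(2πx₀) G`, `S = sin(2πx₀) G`),
any constant `c` (`w := u − c e₀`) and every global Leray–Hopf solution with a sup-energy bound:
`2πc·Λ⟨(C,u)⟩ = −Λ⟨∫⟪w,(w·∇)S⟫⟩ − νΛ⟨(u,ΔS)⟩` and
`2πc·Λ⟨(S,u)⟩ = Λ⟨∫⟪w,(w·∇)C⟫⟩ + νΛ⟨(u,ΔC)⟩ + θ‖G‖₂²`.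
Both are the profile flux law `stub_profileFluxLaw` at the weights `ρ = (2π)⁻¹ sin 2πx₀`
(`∂₀ρ = cos 2πx₀`, `ρG = (2π)⁻¹S`, `∫Φρ‖G‖² = (2π)⁻¹(Φ•G,S) = 0`) and `ρ = −(2π)⁻¹ cos 2πx₀`
(`∂₀ρ = sin 2πx₀`, `ρG = −(2π)⁻¹C`, `∫Φρ‖G‖² = −(2π)⁻¹(Φ•G,C) = −(2π)⁻¹θ‖G‖₂²`), using
`stub_acdcDesignCalculus` / `stub_acdcDesignIntegrals` (`AcdcQuadrature.profileFluxLaw_smul`,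
`AcdcQuadrature.weight_sin`, `AcdcQuadrature.weight_cos`). Consequence for the line: the AC work of
the first-moment law is `2θΛ⟨(C,u)⟩ = −(θ/(πc))[Λ⟨∫⟪w,(w·∇)S⟫⟩ + νΛ⟨(u,ΔS)⟩]`, so conjunct (b) of
the crux for this design says exactly that the wake's Reynolds stress DESTROYS the quadrature
imprint `S` at a ν-uniform rate (Foias–Manley–Rosa–Temam 2001, Ch. IV §3.1; Doering–Foias 2002
§2). The hypotheses `1 ≤ m`, `0 < A` are only used to feed the design stubs. [folklore] -/
theorem stub_acdcQuadratureDictionary :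
    ∀ (Λ : GeneralizedLimit) (ν c : ℝ) (m : ℕ) (A θ : ℝ) (Φ : 𝕋³ → ℝ) (G C S : 𝕋³ → E³)
      (u₀ : 𝕋³ → E³) (u : ℝ → 𝕋³ → E³),
      Φ = (fun x => 1 + 2 * θ * (UnitAddTorus.mFourier (Pi.single (0 : Fin 3) (1 : ℤ)) x).re) →
      G = (fun x => A • (stokesMode ![(0 : ℤ), (m : ℤ), (m : ℤ)]
            (EuclideanSpace.single (1 : Fin 3) (1 : ℝ) - EuclideanSpace.single (2 : Fin 3) (1 : ℝ)) false x +
          stokesMode ![(0 : ℤ), (m : ℤ), -(m : ℤ)]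
            (EuclideanSpace.single (1 : Fin 3) (1 : ℝ) + EuclideanSpace.single (2 : Fin 3) (1 : ℝ)) false x)) →
      C = (fun x => (UnitAddTorus.mFourier (Pi.single (0 : Fin 3) (1 : ℤ)) x).re • G x) →
      S = (fun x => (UnitAddTorus.mFourier (Pi.single (0 : Fin 3) (1 : ℤ)) x).im • G x) →
      1 ≤ m → 0 < A → 0 < θ → 0 < ν →
      IsGlobalLerayHopf ν (fun _ => fun x => Φ x • G x) u₀ u →
      (∃ K : ℝ, ∀ t : ℝ, 0 ≤ t → kineticEnergy (u t) ≤ K) →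
      (2 * Real.pi * c * Λ.longTimeAvg (fun t => ∫ x, ⟪C x, u t x⟫) =
          -Λ.longTimeAvg (fun t => ∫ x, ⟪u t x - c • EuclideanSpace.single 0 1,
              convect (fun y => u t y - c • EuclideanSpace.single 0 1) S x⟫) -
            ν * Λ.longTimeAvg (fun t => ∫ x, ⟪u t x, laplacian S x⟫)) ∧
      (2 * Real.pi * c * Λ.longTimeAvg (fun t => ∫ x, ⟪S x, u t x⟫) =
          Λ.longTimeAvg (fun t => ∫ x, ⟪u t x - c • EuclideanSpace.single 0 1,
              convect (fun y => u t y - c • EuclideanSpace.single 0 1) C x⟫) +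
            ν * Λ.longTimeAvg (fun t => ∫ x, ⟪u t x, laplacian C x⟫) + θ * ∫ x, ‖G x‖ ^ 2) := by
  intro Λ ν c m A θ Φ G C S u₀ u hΦ hG hC hS hm hA hθ hν hu hK
  -- the design clauses of the sibling `GridThesis` line (calculus and integrals)
  obtain ⟨hΦs, -, hGs, -, hGinv, hG0, hGdiv, -, -, -, -, hCs, hSs, -, -, -, -, -⟩ :=
    stub_acdcDesignCalculus m A θ Φ _ G C S hΦ rfl hG hC hS hm hA hθ
  obtain ⟨-, -, hIC, hIS, -, -⟩ := stub_acdcDesignIntegrals m A θ Φ _ G C S hΦ rfl hG hC hS hm hA hθ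
  -- the two quadrature weights `(2π)⁻¹ Im e₀` and `-(2π)⁻¹ Re e₀`
  obtain ⟨hρ₁, hρ₁inv, hdρ₁⟩ := AcdcQuadrature.weight_sin _ rfl
  obtain ⟨hρ₂, hρ₂inv, hdρ₂⟩ := AcdcQuadrature.weight_cos _ rfl
  have hπ : 2 * Real.pi * (2 * Real.pi)⁻¹ = 1 := mul_inv_cancel₀ (by positivity)
  refine ⟨?_, ?_⟩
  · -- weight `(2π)⁻¹ Im e₀`: `∂₀ρ•G = C`, `ρ•G = (2π)⁻¹•S`, `∫Φρ‖G‖² = (2π)⁻¹ (Φ•G, S) = 0`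
    have hT : ∀ x, partialDeriv 0 (fun y =>
        (2 * Real.pi)⁻¹ * (UnitAddTorus.mFourier (Pi.single (0 : Fin 3) (1 : ℤ)) y).im) x • G x =
        C x := by
      intro x
      rw [hdρ₁ x, hC]
    have hρG : ∀ x, ((2 * Real.pi)⁻¹ * (UnitAddTorus.mFourier (Pi.single (0 : Fin 3) (1 : ℤ)) x).im) •
        G x = (2 * Real.pi)⁻¹ • S x := by
      intro x
      rw [hS, mul_smul]
    have hI : ∫ x, Φ x * ((2 * Real.pi)⁻¹ *
        (UnitAddTorus.mFourier (Pi.single (0 : Fin 3) (1 : ℤ)) x).im) * ‖G x‖ ^ 2 = 0 := by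
      have e : ∀ x, Φ x * ((2 * Real.pi)⁻¹ *
          (UnitAddTorus.mFourier (Pi.single (0 : Fin 3) (1 : ℤ)) x).im) * ‖G x‖ ^ 2 =
          (2 * Real.pi)⁻¹ * ⟪Φ x • G x, S x⟫ := by
        intro x
        rw [hS]
        dsimp only
        rw [real_inner_smul_left, real_inner_smul_right, real_inner_self_eq_norm_sq]
        ring
      simp_rw [e]
      rw [integral_const_mul, hIS, mul_zero]
    have h := AcdcQuadrature.profileFluxLaw_smul Λ ν c (2 * Real.pi)⁻¹ Φ _ G C S u₀ u hν hΦs hρ₁ hGs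
      hρ₁inv hGinv hG0 hGdiv hSs hT hρG hu hK
    have key : ∀ {X B L I : ℝ},
        c * X + (2 * Real.pi)⁻¹ * B + ν * ((2 * Real.pi)⁻¹ * L) + I = 0 → I = 0 →
        2 * Real.pi * c * X = -B - ν * L := by
      intro X B L I h hI
      subst hI
      linear_combination (2 * Real.pi) * h - (B + ν * L) * hπ
    exact key h hI
  · -- weight `-(2π)⁻¹ Re e₀`: `∂₀ρ•G = S`, `ρ•G = -(2π)⁻¹•C`, `∫Φρ‖G‖² = -(2π)⁻¹ θ ∫‖G‖²`
    have hT : ∀ x, partialDeriv 0 (fun y =>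
        -(2 * Real.pi)⁻¹ * (UnitAddTorus.mFourier (Pi.single (0 : Fin 3) (1 : ℤ)) y).re) x • G x =
        S x := by
      intro x
      rw [hdρ₂ x, hS]
    have hρG : ∀ x, (-(2 * Real.pi)⁻¹ * (UnitAddTorus.mFourier (Pi.single (0 : Fin 3) (1 : ℤ)) x).re) •
        G x = (-(2 * Real.pi)⁻¹) • C x := by
      intro x
      rw [hC, mul_smul]
    have hI : ∫ x, Φ x * (-(2 * Real.pi)⁻¹ *
        (UnitAddTorus.mFourier (Pi.single (0 : Fin 3) (1 : ℤ)) x).re) * ‖G x‖ ^ 2 =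
        -(2 * Real.pi)⁻¹ * (θ * ∫ x, ‖G x‖ ^ 2) := by
      have e : ∀ x, Φ x * (-(2 * Real.pi)⁻¹ *
          (UnitAddTorus.mFourier (Pi.single (0 : Fin 3) (1 : ℤ)) x).re) * ‖G x‖ ^ 2 =
          -(2 * Real.pi)⁻¹ * ⟪Φ x • G x, C x⟫ := by
        intro x
        rw [hC]
        dsimp only
        rw [real_inner_smul_left, real_inner_smul_right, real_inner_self_eq_norm_sq]
        ring
      simp_rw [e]
      rw [integral_const_mul, hIC]
    have h := AcdcQuadrature.profileFluxLaw_smul Λ ν c (-(2 * Real.pi)⁻¹) Φ _ G S C u₀ u hν hΦs hρ₂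
      hGs hρ₂inv hGinv hG0 hGdiv hCs hT hρG hu hK
    have key : ∀ {X B L I N : ℝ},
        c * X + -(2 * Real.pi)⁻¹ * B + ν * (-(2 * Real.pi)⁻¹ * L) + I = 0 →
        I = -(2 * Real.pi)⁻¹ * (θ * N) → 2 * Real.pi * c * X = B + ν * L + θ * N := by
      intro X B L I N h hI
      subst hI
      linear_combination (2 * Real.pi) * h + (B + ν * L + θ * N) * hπ
    exact key h hI

end Summit.AnomalousDissipation.AnomalousDissipation.Theorems

end
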